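import Literature.NumberTheory.ComplexMultiplication.CMOrderWeakEquivalenceSingularPrimes
import HarnessLib

/-!
# `𝒮`-equivalence at a finite set of ideals is one condition modulo their product (MARSEGLIA 2025 PROP. 3.4
# (4) ⟺ (5)): `1 ∈ (I:J)(J:I) + 𝔞ᵢ` for every `i` iff `1 ∈ (I:J)(J:I) + ∏ᵢ 𝔞ᵢ`, for ANY finite family of ideals

Family `hodge`, lane `lit-hodgefound` (Track 2 foundations library; seat p15, row g26-#18), topic
`Literature/NumberTheory/ComplexMultiplication`, namespace `Literature.NumberTheory.ComplexMultiplication.NumberRing` (any domain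
`R` with fraction field `K`) with an `EndOrder` packaging (§3).  THEOREMS ONLY: no definition, no instance, no named
fact (net Literature debt `0`).  Vocabulary: `FractionalIdeal R⁰ K`, `(I:J) = I / J`, `N = (I:J)(J:I)`; ideals `𝔞` of `R`
enter as `(𝔞 : FractionalIdeal R⁰ K)`.

## Source, VERBATIM

S. Marseglia, *Local isomorphism classes of fractional ideals of orders in étale algebras*, J. Algebra 673 (2025)
77–102 [Marseglia2025LocalIsomorphism] (arXiv:2311.18571, held `paper:arxiv-2311.18571`, chunk p0006):
"Proposition 3.4. Let `I` and `J` be fractional `R`-ideals. The following statements are equivalent: (1) `I` and `J`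
are `𝒮`-equivalent. (2) `1 ∈ (I:J)(J:I) + 𝔭` for every `𝔭` in `𝒮`. (3) `I` and `J` are `𝒮₀`-equivalent.
(4) `1 ∈ (I:J)(J:I) + 𝔭` for every `𝔭` in `𝒮₀`. (5) `1 ∈ (I:J)(J:I) + ∏_{𝔭 ∈ 𝒮₀} 𝔭`.  Proof. … Assume now that (4)
holds, and set `M = ((I:J)(J:I) + ∏_{𝔭 ∈ 𝒮₀} 𝔭) ∩ R`. By assumption, `M_𝔭 = R_𝔭` for every `𝔭 ∈ 𝒮₀`. Note that if `𝔮`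
is a maximal ideal of `R` not in `𝒮₀` then also `M_𝔮 = R_𝔮`. Therefore `M = R` which implies (5). The fact that (5)
implies (4) is clear. □"

The implication (4) ⟹ (5) is obtained here by an elementary global computation instead of the printed localisation:
`N = (I:J)(J:I)` is multiplicatively closed (`N·N ⊆ (I:J)(J:J)(J:I) ⊆ N`), so from `1 = n₁ + a`, `1 = n₂ + b` one gets
`1 = (n₁n₂ + n₁b + an₂) + ab ∈ N + 𝔞𝔟`; this works for every finite family of ideals, maximal or not, and for powers.

## What is formalised

* §1 **`div_mul_div_mul_self_le`** (`N·N ⊆ N`), **`one_mem_add_coeIdeal_mul_of_one_mem_add`** (`1 ∈ N+𝔞`, `1 ∈ N+𝔟 ⟹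
  1 ∈ N+𝔞𝔟` for `N·N ⊆ N`), `one_mem_add_coeIdeal_pow_of_one_mem_add` (`⟹ 1 ∈ N + 𝔞ⁿ`),
  **`one_mem_add_coeIdeal_prod_of_forall`** (finite products), `one_mem_add_coeIdeal_of_le` (the «clear» converse).
* §2 **`one_mem_div_mul_div_add_prod_iff_forall`** (PROP. 3.4 (4) ⟺ (5) for `N = (I:J)(J:I)` and any finite family),
  **`one_mem_div_mul_div_add_prod_pow_iff_forall`** (the same with exponents `𝔭^{e_𝔭}`, as in the proof of Thm. 4.4).
* §3 the order `𝔯 = endOrder ρ`: `EndOrder.one_mem_div_mul_div_add_prod_iff_forall`.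
-/

open scoped nonZeroDivisors NumberField
open Module FractionalIdeal NumberField

namespace Literature.NumberTheory.ComplexMultiplication

namespace NumberRing

/-! ## §1 `N = (I:J)(J:I)` is multiplicatively closed; `1 ∈ N + 𝔞`, `1 ∈ N + 𝔟 ⟹ 1 ∈ N + 𝔞𝔟` -/

section AnyDomain

variable {R : Type*} [CommRing R] [IsDomain R] {K : Type*} [Field K] [Algebra R K] [IsFractionRing R K]

/-- **`N·N ⊆ N` for `N = (I:J)(J:I)`** (`(J:I)(I:J) ⊆ (J:J)` and `(I:J)(J:J) ⊆ (I:J)`; `I`, `J ≠ 0`).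
[cite: Marseglia2019, §4, proof of Prop. 4.1 («By definition of quotient ideal … `(I:J)(J:I) ⊆ (J:J)`»), p. 8]
[cite: Marseglia2025LocalIsomorphism, §3 Prop. 3.4 (proof), p. 6] -/
theorem div_mul_div_mul_self_le {I J : FractionalIdeal R⁰ K} (hI : I ≠ 0) (hJ : J ≠ 0) :
    I / J * (J / I) * (I / J * (J / I)) ≤ I / J * (J / I) := by
  -- `(J:I)(I:J) ⊆ (J:J)` and `(I:J)(J:J) ⊆ (I:J)`
  have h1 : J / I * (I / J) ≤ J / J := by
    refine (le_div_iff_mul_le hJ).2 ?_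
    calc J / I * (I / J) * J = J / I * (I / J * J) := mul_assoc _ _ _
      _ ≤ J / I * I := mul_le_mul' le_rfl ((le_div_iff_mul_le hJ).1 le_rfl)
      _ ≤ J := (le_div_iff_mul_le hI).1 le_rfl
  have h2 : I / J * (J / J) ≤ I / J := by
    refine (le_div_iff_mul_le hJ).2 ?_
    calc I / J * (J / J) * J = I / J * (J / J * J) := mul_assoc _ _ _
      _ ≤ I / J * J := mul_le_mul' le_rfl ((le_div_iff_mul_le hJ).1 le_rfl)
      _ ≤ I := (le_div_iff_mul_le hJ).1 le_rfl
  calc I / J * (J / I) * (I / J * (J / I)) = I / J * (J / I * (I / J)) * (J / I) := by ring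
    _ ≤ I / J * (J / J) * (J / I) := mul_le_mul' (mul_le_mul' le_rfl h1) le_rfl
    _ ≤ I / J * (J / I) := mul_le_mul' h2 le_rfl

omit [IsDomain R] [IsFractionRing R K] in
/-- **`1 ∈ N + 𝔞` and `1 ∈ N + 𝔟 ⟹ 1 ∈ N + 𝔞𝔟` when `N·N ⊆ N`**: `1 = (n₁ + a)(n₂ + b) = (n₁n₂ + n₁b + an₂) + ab`.
[cite: Marseglia2025LocalIsomorphism, §3 Prop. 3.4 ((4) ⟹ (5)), p. 6] -/
theorem one_mem_add_coeIdeal_mul_of_one_mem_add {N : FractionalIdeal R⁰ K} (hNN : N * N ≤ N) {𝔞 𝔟 : Ideal R}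
    (ha : (1 : K) ∈ N + (𝔞 : FractionalIdeal R⁰ K)) (hb : (1 : K) ∈ N + (𝔟 : FractionalIdeal R⁰ K)) :
    (1 : K) ∈ N + ((𝔞 * 𝔟 : Ideal R) : FractionalIdeal R⁰ K) := by
  rw [← mem_coe, coe_add, Submodule.add_eq_sup, Submodule.mem_sup] at ha hb ⊢
  obtain ⟨n₁, hn₁, a, ha, h1⟩ := ha
  obtain ⟨n₂, hn₂, b, hb, h2⟩ := hb
  obtain ⟨a', ha', rfl⟩ := (mem_coeIdeal R⁰).1 ha
  obtain ⟨b', hb', rfl⟩ := (mem_coeIdeal R⁰).1 hb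
  refine ⟨n₁ * n₂ + a' • n₂ + b' • n₁, ?_, algebraMap R K a' * algebraMap R K b', ?_, ?_⟩
  · exact add_mem (add_mem (hNN (mul_mem_mul hn₁ hn₂)) (Submodule.smul_mem _ a' hn₂)) (Submodule.smul_mem _ b' hn₁)
  · rw [← map_mul]
    exact (mem_coeIdeal R⁰).2 ⟨a' * b', Ideal.mul_mem_mul ha' hb', rfl⟩
  · calc n₁ * n₂ + a' • n₂ + b' • n₁ + algebraMap R K a' * algebraMap R K b'
        = (n₁ + algebraMap R K a') * (n₂ + algebraMap R K b') := by rw [Algebra.smul_def, Algebra.smul_def]; ring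
      _ = 1 := by rw [h1, h2, one_mul]

omit [IsDomain R] [IsFractionRing R K] in
/-- **`1 ∈ N + 𝔞 ⟹ 1 ∈ N + 𝔞ⁿ`** (`n ≥ 1`, `N·N ⊆ N`). [cite: Marseglia2025LocalIsomorphism, §3 Prop. 3.4 ((4) ⟹ (5)) and §4,
proof of Thm. 4.4 («`I_i + 𝔭_i^{k_i}`»), pp. 6, 8] -/
theorem one_mem_add_coeIdeal_pow_of_one_mem_add {N : FractionalIdeal R⁰ K} (hNN : N * N ≤ N) {𝔞 : Ideal R}
    (ha : (1 : K) ∈ N + (𝔞 : FractionalIdeal R⁰ K)) {n : ℕ} (hn : 0 < n) :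
    (1 : K) ∈ N + ((𝔞 ^ n : Ideal R) : FractionalIdeal R⁰ K) := by
  induction n with
  | zero => exact absurd hn (lt_irrefl 0)
  | succ m ih =>
    rcases Nat.eq_zero_or_pos m with rfl | hm
    · rwa [zero_add, pow_one]
    · rw [pow_succ]
      exact one_mem_add_coeIdeal_mul_of_one_mem_add hNN (ih hm) ha

omit [IsDomain R] [IsFractionRing R K] in
/-- **`1 ∈ N + 𝔞ᵢ` for all `i ∈ F ⟹ 1 ∈ N + ∏_{i ∈ F} 𝔞ᵢ`** (`F` finite, `N·N ⊆ N`). [cite: Marseglia2025LocalIsomorphism,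
§3 Prop. 3.4 ((4) ⟹ (5)), p. 6] -/
theorem one_mem_add_coeIdeal_prod_of_forall {N : FractionalIdeal R⁰ K} (hNN : N * N ≤ N) {α : Type*} (F : Finset α)
    (𝔞 : α → Ideal R) (h : ∀ i ∈ F, (1 : K) ∈ N + (𝔞 i : FractionalIdeal R⁰ K)) :
    (1 : K) ∈ N + ((∏ i ∈ F, 𝔞 i : Ideal R) : FractionalIdeal R⁰ K) := by
  classical
  induction F using Finset.induction_on with
  | empty =>
    rw [Finset.prod_empty, Ideal.one_eq_top, coeIdeal_top, ← mem_coe, coe_add, Submodule.add_eq_sup]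
    exact Submodule.mem_sup_right (one_mem_one _)
  | insert i F hi ih =>
    rw [Finset.prod_insert hi]
    exact one_mem_add_coeIdeal_mul_of_one_mem_add hNN (h i (Finset.mem_insert_self i F))
      (ih fun j hj ↦ h j (Finset.mem_insert_of_mem hj))

omit [IsDomain R] in
/-- **«The fact that (5) implies (4) is clear»**: `1 ∈ N + 𝔞 ⟹ 1 ∈ N + 𝔟` for `𝔞 ⊆ 𝔟`.
[cite: Marseglia2025LocalIsomorphism, §3 Prop. 3.4 ((5) ⟹ (4)), p. 6] -/
theorem one_mem_add_coeIdeal_of_le {N : FractionalIdeal R⁰ K} {𝔞 𝔟 : Ideal R} (hle : 𝔞 ≤ 𝔟)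
    (ha : (1 : K) ∈ N + (𝔞 : FractionalIdeal R⁰ K)) : (1 : K) ∈ N + (𝔟 : FractionalIdeal R⁰ K) := by
  rw [← mem_coe, coe_add, Submodule.add_eq_sup, Submodule.mem_sup] at ha ⊢
  obtain ⟨n, hn, a, ha, h⟩ := ha
  exact ⟨n, hn, a, coeIdeal_le_coeIdeal K |>.2 hle ha, h⟩

/-! ## §2 Proposition 3.4 (4) ⟺ (5) for `N = (I:J)(J:I)` -/

/-- **PROPOSITION 3.4 (4) ⟺ (5) for ANY finite family of ideals: `1 ∈ (I:J)(J:I) + 𝔞ᵢ` for all `i ∈ F` iff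
`1 ∈ (I:J)(J:I) + ∏_{i ∈ F} 𝔞ᵢ`** (`I`, `J ≠ 0`). [cite: Marseglia2025LocalIsomorphism, §3 Prop. 3.4 ((4) ⟺ (5)), p. 6] -/
theorem one_mem_div_mul_div_add_prod_iff_forall {I J : FractionalIdeal R⁰ K} (hI : I ≠ 0) (hJ : J ≠ 0) {α : Type*}
    (F : Finset α) (𝔞 : α → Ideal R) :
    (1 : K) ∈ I / J * (J / I) + ((∏ i ∈ F, 𝔞 i : Ideal R) : FractionalIdeal R⁰ K) ↔
      ∀ i ∈ F, (1 : K) ∈ I / J * (J / I) + (𝔞 i : FractionalIdeal R⁰ K) := by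
  classical
  refine ⟨fun h i hi ↦ one_mem_add_coeIdeal_of_le ?_ h,
    one_mem_add_coeIdeal_prod_of_forall (div_mul_div_mul_self_le hI hJ) F 𝔞⟩
  rw [← Finset.prod_erase_mul F 𝔞 hi]
  exact Ideal.mul_le_left

/-- **PROPOSITION 3.4 (4) ⟺ (5) with exponents: `1 ∈ (I:J)(J:I) + 𝔞ᵢ` for all `i ∈ F` iff
`1 ∈ (I:J)(J:I) + ∏_{i ∈ F} 𝔞ᵢ^{eᵢ}`** (`eᵢ ≥ 1`). [cite: Marseglia2025LocalIsomorphism, §3 Prop. 3.4 ((4) ⟺ (5)) and §4,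
proof of Thm. 4.4, pp. 6, 8] -/
theorem one_mem_div_mul_div_add_prod_pow_iff_forall {I J : FractionalIdeal R⁰ K} (hI : I ≠ 0) (hJ : J ≠ 0) {α : Type*}
    (F : Finset α) (𝔞 : α → Ideal R) (e : α → ℕ) (he : ∀ i ∈ F, 0 < e i) :
    (1 : K) ∈ I / J * (J / I) + ((∏ i ∈ F, 𝔞 i ^ e i : Ideal R) : FractionalIdeal R⁰ K) ↔
      ∀ i ∈ F, (1 : K) ∈ I / J * (J / I) + (𝔞 i : FractionalIdeal R⁰ K) := by
  classical
  constructor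
  · intro h i hi
    refine one_mem_add_coeIdeal_of_le ?_ h
    rw [← Finset.prod_erase_mul F _ hi]
    exact Ideal.mul_le_left.trans (Ideal.pow_le_self (he i hi).ne')
  · intro h
    exact one_mem_add_coeIdeal_prod_of_forall (div_mul_div_mul_self_le hI hJ) F (fun i ↦ 𝔞 i ^ e i) fun i hi ↦
      one_mem_add_coeIdeal_pow_of_one_mem_add (div_mul_div_mul_self_le hI hJ) (h i hi) (he i hi)

end AnyDomain

end NumberRing

/-! ## §3 The order `𝔯 = endOrder ρ` -/

namespace EndOrder

variable {K : Type} [Field K] [NumberField K]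
variable {ι : Type} [Fintype ι] [DecidableEq ι] {ρ : K →ₐ[ℚ] Matrix ι ι ℚ}
variable [IsFractionRing (endOrder ρ) K]

/-- **PROPOSITION 3.4 (4) ⟺ (5) for the order `𝔯 = endOrder ρ` and any finite set `F` of maximal ideals: `I`, `J` are
`𝔭`-equivalent at every `𝔭 ∈ F` iff `1 ∈ (I:J)(J:I) + ∏_{𝔭 ∈ F} 𝔭`.** [cite: Marseglia2025LocalIsomorphism, §3 Prop. 3.4
((4) ⟺ (5)), p. 6] -/
theorem one_mem_div_mul_div_add_prod_iff_forall {I J : FractionalIdeal (endOrder ρ)⁰ K} (hI : I ≠ 0) (hJ : J ≠ 0)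
    (F : Finset (MaximalSpectrum (endOrder ρ))) :
    (1 : K) ∈ I / J * (J / I) + ((∏ 𝔭 ∈ F, 𝔭.asIdeal : Ideal (endOrder ρ)) : FractionalIdeal (endOrder ρ)⁰ K) ↔
      ∀ 𝔭 ∈ F, (1 : K) ∈ I / J * (J / I) + (𝔭.asIdeal : FractionalIdeal (endOrder ρ)⁰ K) :=
  NumberRing.one_mem_div_mul_div_add_prod_iff_forall hI hJ F fun 𝔭 ↦ 𝔭.asIdeal

end EndOrder

end Literature.NumberTheory.ComplexMultiplication
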